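import Summits.BirchSwinnertonDyer.Rank1Residual.X2.GreenbergVatsalTateDatumRat
import HarnessLib

/-!
# At a multiplicative prime `2` of `E/ℚ` the local inertia group fixes `√γ(E)`, `γ = −c₄/c₆`
# (`ℚ₂(√γ)/ℚ₂` is unramified: `−c₄c₆ ≡ 1 (mod 4)` for the minimal model) — cell `b2b-bsdres`,
# unit `b2b-bsdres-eisenstein-p2`, gen 30, programme P1

HONEST FRAMING (run/shared/lean/b2b/bsd-rank1-residual/, verbatim in every file): the goal of the
cell is to DELETE the COMBINATION-SHAPED residual classes of the Birch–Swinnerton-Dyer formula for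
ALL analytic-rank `≤ 1` elliptic curves over `ℚ` — "full BSD formula for every rank `≤ 1` curve in
class `C`" assembled STRICTLY from published theorems — so that the rank-`≤ 1` remainder becomes
exactly the CONSTRUCTION-SHAPED classes, which are TYPED (missing-input `Prop`s), NOT attempted.
This is not "finishing BSD". Research route; NO CLAIM BEYOND STATED CLASSES; nothing here changes a
label. Theorems only; no definition, no named fact, no `sorry`.

WHAT. Gen 9's `GreenbergVatsalTateDatumRat.inertia_fix_sqrt_gamma` discharges the hypothesis `ht` of
the twisted Tate uniformisation ("the local inertia group fixes `t = √γ(E)`", i.e. `K_v(t)/K_v`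
unramified, Silverman *ATAEC* V Ex. 5.11) at an ODD multiplicative prime (`|σt − t| < 1` against
`|2t| = 1`). Programme P1 (the upper half of Greenberg–Vatsal Cor. (2.3)/Prop. (2.4): local analysis
at EVERY bad place `ℓ ≠ p`, X2-GAP §34.6) also needs the prime `ℓ = 2`:

* `intCast_c₄_zmod_four`, `intCast_c₆_zmod_four` — for an integral Weierstrass equation,
  `c₄ ≡ a₁⁴` and `c₆ ≡ −a₁⁶ (mod 4)`;
* `four_dvd_neg_c₄_mul_c₆_sub_one` — hence `c₄` odd forces `−c₄c₆ ≡ 1 (mod 4)`;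
* **`inertia_fix_sqrt_gamma_two`** — for the globally minimal `E/ℚ` with multiplicative reduction
  at `2` and `t ∈ ℚ̄_v`, `v = (2)`, with `t² = γ = −c₄/c₆`: every `σ` of the local inertia group fixes
  `t`. Proof: `t' = c₆ t` has `t'² = g = −c₄c₆ ≡ 1 (mod 4)`; `u = (1 + t')/2` is a root of
  `X² − X − (g − 1)/4`, hence a local integer, and `σu ∈ {u, 1 − u}`; `σu = 1 − u` would give
  `|σu − u|_v = |t'|_v = 1`, against `|σu − u|_v < 1` for `σ` in the inertia group (Neukirch II (9.3)).

References: [SilvermanATAEC1994] Ch. V Lemma 5.2, Thm. 5.3, Cor. 5.4, Ex. 5.11;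
[SilvermanAEC2009] III §1 (`b₂, b₄, b₆, c₄, c₆`), VII.5.1(b); [NeukirchANT1999] II (9.3);
HOME X2-GAP.md §34.6.
-/

set_option autoImplicit false

noncomputable section

open scoped Classical NNReal

open NumberField IsDedekindDomain Field
open Literature.NumberTheory.EllipticCurves Literature.NumberTheory.GaloisRepresentations
  IsDedekindDomain.HeightOneSpectrum
open WeierstrassCurve (integralModelInt)

namespace Summit.BirchSwinnertonDyer.Rank1Residual.X2.TateTwistUnramifiedAtTwo

/-! ## §1. `c₄ ≡ a₁⁴`, `c₆ ≡ −a₁⁶ (mod 4)`; `c₄` odd ⇒ `−c₄c₆ ≡ 1 (mod 4)` -/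

/-- `c₄ ≡ a₁⁴ (mod 4)` for an integral Weierstrass equation (`c₄ = b₂² − 24b₄`, `b₂ = a₁² + 4a₂`).
[cite: SilvermanAEC2009, III §1 (b₂, b₄, c₄)] -/
theorem intCast_c₄_zmod_four (E : WeierstrassCurve ℤ) :
    ((E.c₄ : ℤ) : ZMod 4) = ((E.a₁ : ℤ) : ZMod 4) ^ 4 := by
  have h1 : ((E.c₄ : ℤ) : ZMod 4) = (E.map (Int.castRingHom (ZMod 4))).c₄ := by
    rw [WeierstrassCurve.map_c₄]; rfl
  rw [h1]
  simp only [WeierstrassCurve.c₄, WeierstrassCurve.b₂, WeierstrassCurve.b₄, WeierstrassCurve.map_a₁,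
    WeierstrassCurve.map_a₂, WeierstrassCurve.map_a₃, WeierstrassCurve.map_a₄, eq_intCast]
  rw [show (4 : ZMod 4) = 0 by decide, show (24 : ZMod 4) = 0 by decide]
  ring

/-- `c₆ ≡ −a₁⁶ (mod 4)` for an integral Weierstrass equation
(`c₆ = −b₂³ + 36b₂b₄ − 216b₆`). [cite: SilvermanAEC2009, III §1 (b₂, b₄, b₆, c₆)] -/
theorem intCast_c₆_zmod_four (E : WeierstrassCurve ℤ) :
    ((E.c₆ : ℤ) : ZMod 4) = -((E.a₁ : ℤ) : ZMod 4) ^ 6 := by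
  have h1 : ((E.c₆ : ℤ) : ZMod 4) = (E.map (Int.castRingHom (ZMod 4))).c₆ := by
    rw [WeierstrassCurve.map_c₆]; rfl
  rw [h1]
  simp only [WeierstrassCurve.c₆, WeierstrassCurve.b₂, WeierstrassCurve.b₄, WeierstrassCurve.b₆,
    WeierstrassCurve.map_a₁, WeierstrassCurve.map_a₂, WeierstrassCurve.map_a₃, WeierstrassCurve.map_a₄,
    WeierstrassCurve.map_a₆, eq_intCast]
  rw [show (4 : ZMod 4) = 0 by decide, show (36 : ZMod 4) = 0 by decide,
    show (216 : ZMod 4) = 0 by decide]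
  ring

/-- **`c₄` odd ⇒ `−c₄c₆ ≡ 1 (mod 4)`** for an integral Weierstrass equation: `c₄ ≡ a₁⁴`,
`c₆ ≡ −a₁⁶ (mod 4)`, and `a₁⁴ ≢ 0 (mod 4)` forces `a₁` odd, `a₁⁴ ≡ a₁⁶ ≡ 1`.
[cite: SilvermanAEC2009, III §1 (c₄, c₆)] -/
theorem four_dvd_neg_c₄_mul_c₆_sub_one (E : WeierstrassCurve ℤ) (h : ¬ (2 : ℤ) ∣ E.c₄) :
    (4 : ℤ) ∣ -(E.c₄ * E.c₆) - 1 := by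
  have key : ∀ a : ZMod 4, a ^ 4 = 0 ∨ (a ^ 4 = 1 ∧ a ^ 6 = 1) := by decide
  have h4 := intCast_c₄_zmod_four E
  have h6 := intCast_c₆_zmod_four E
  rcases key ((E.a₁ : ℤ) : ZMod 4) with h0 | ⟨h14, h16⟩
  · -- then `4 ∣ c₄`, contradicting `c₄` odd
    exfalso
    rw [h0, ZMod.intCast_zmod_eq_zero_iff_dvd] at h4
    exact h (dvd_trans (by norm_num) h4)
  · have h' : (((-(E.c₄ * E.c₆) - 1 : ℤ)) : ZMod 4) = 0 := by
      push_cast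
      rw [h4, h6, h14, h16]
      ring
    have h'' := (ZMod.intCast_zmod_eq_zero_iff_dvd _ 4).1 h'
    exact_mod_cast h''

/-! ## §2. The local inertia group at `2` fixes `√γ(E)` -/

/-- **At a multiplicative prime `2` of the globally minimal `E/ℚ`, the local inertia group fixes
`t = √γ(E)`, `γ = −c₄/c₆`** (the hypothesis `ht` of the twisted Tate uniformisation at `v = (2)`;
Silverman *ATAEC* V Ex. 5.11: `ℚ₂(√γ)/ℚ₂` unramified). With `c₄, c₆` of the minimal model odd and
`g = −c₄c₆ ≡ 1 (mod 4)` (§1): `t' = c₆t` has `t'² = g`, `u = (1 + t')/2` is a root of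
`X² − X − (g−1)/4 ∈ ℤ[X]`, so `|u|_v ≤ 1` and `σu ∈ {u, 1 − u}` for every `σ`; for `σ` in the
inertia group `|σu − u|_v < 1` (Neukirch II (9.3)) while `|1 − 2u|_v = |t'|_v = 1`, so `σu = u`,
`σt' = t'`, `σt = t`. [cite: SilvermanATAEC1994, Ch. V Lemma 5.2 (c), Thm. 5.3 (a),(b), Cor. 5.4 (held copy PDF pp. 406–410)]
[cite: SilvermanAEC2009, VII.5 Prop. 5.1(b)] [cite: NeukirchANT1999, Ch. II (9.3)] -/
theorem inertia_fix_sqrt_gamma_two (W : WeierstrassCurve ℚ) [W.IsElliptic] [W.IsGloballyMinimal]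
    (hmult : W.HasMultiplicativeReductionAtPrime 2) {v : HeightOneSpectrum (𝓞 ℚ)}
    (hpv : ((2 : ℕ) : 𝓞 ℚ) ∈ v.asIdeal) :
    ∀ t : AlgebraicClosure (v.adicCompletion ℚ),
      t ^ 2 = algebraMap (v.adicCompletion ℚ) (AlgebraicClosure (v.adicCompletion ℚ))
        (algebraMap ℚ (v.adicCompletion ℚ) (-(W.c₄ / W.c₆))) →
      ∀ σ ∈ absInertia (v.adicCompletion ℚ),
        Field.absoluteGaloisGroup.toAlgEquiv (v.adicCompletion ℚ) σ t = t := by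
  haveI : Fact (Nat.Prime 2) := ⟨Nat.prime_two⟩
  intro t ht σ hσ
  obtain ⟨w, hw⟩ := v.exists_spectralValuation
  haveI : CharZero (AlgebraicClosure (v.adicCompletion ℚ)) :=
    charZero_of_injective_algebraMap (algebraMap ℚ (AlgebraicClosure (v.adicCompletion ℚ))).injective
  obtain ⟨-, hc₄⟩ := Additive.dvd_and_not_dvd_c₄_of_hasMultiplicativeReductionAtPrime W 2 hmult
  have hc₆ := GreenbergVatsalTateDatumRat.not_dvd_c₆_of_hasMultiplicativeReductionAtPrime W hmult
  -- `γ` in `ℚ̄_v`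
  have h4 : W.c₄ = ((integralModelInt W).c₄ : ℚ) := by
    conv_lhs => rw [← WeierstrassCurve.map_integralModelInt W]
    rw [WeierstrassCurve.map_c₄, eq_intCast]
  have h6 : W.c₆ = ((integralModelInt W).c₆ : ℚ) := by
    conv_lhs => rw [← WeierstrassCurve.map_integralModelInt W]
    rw [WeierstrassCurve.map_c₆, eq_intCast]
  have hγ : algebraMap (v.adicCompletion ℚ) (AlgebraicClosure (v.adicCompletion ℚ))
      (algebraMap ℚ (v.adicCompletion ℚ) (-(W.c₄ / W.c₆))) =
      -((((integralModelInt W).c₄ : ℤ) : AlgebraicClosure (v.adicCompletion ℚ)) /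
        (((integralModelInt W).c₆ : ℤ) : AlgebraicClosure (v.adicCompletion ℚ))) := by
    rw [← IsScalarTower.algebraMap_apply ℚ (v.adicCompletion ℚ)
      (AlgebraicClosure (v.adicCompletion ℚ)), h4, h6, map_neg, map_div₀, map_intCast, map_intCast]
  have hc60 : (((integralModelInt W).c₆ : ℤ) : AlgebraicClosure (v.adicCompletion ℚ)) ≠ 0 := by
    rw [Int.cast_ne_zero]; intro h0; exact hc₆ (by rw [h0]; exact dvd_zero _)
  -- `t' = c₆ t`, `t'² = g = -c₄c₆`, `g = 4m + 1`
  set g : ℤ := -((integralModelInt W).c₄ * (integralModelInt W).c₆) with hgdef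
  obtain ⟨m, hm⟩ : ∃ m : ℤ, g - 1 = 4 * m := four_dvd_neg_c₄_mul_c₆_sub_one _ hc₄
  set t' : AlgebraicClosure (v.adicCompletion ℚ) :=
    (((integralModelInt W).c₆ : ℤ) : AlgebraicClosure (v.adicCompletion ℚ)) * t with ht'def
  have ht'2 : t' ^ 2 = (g : AlgebraicClosure (v.adicCompletion ℚ)) := by
    rw [ht'def, mul_pow, ht, hγ, hgdef]
    push_cast
    field_simp
  -- valuations: `|c₆| = |t| = |t'| = 1`
  have hw4 : w (((integralModelInt W).c₄ : ℤ) : AlgebraicClosure (v.adicCompletion ℚ)) = 1 :=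
    spectralValuation_intCast_eq_one_of_natCast_mem hpv hw hc₄
  have hw6 : w (((integralModelInt W).c₆ : ℤ) : AlgebraicClosure (v.adicCompletion ℚ)) = 1 :=
    spectralValuation_intCast_eq_one_of_natCast_mem hpv hw hc₆
  have hwt2 : w t ^ 2 = 1 := by
    rw [← map_pow, ht, hγ, Valuation.map_neg, map_div₀, hw4, hw6, div_one]
  have hwt : w t = 1 := by
    rcases lt_trichotomy (w t) 1 with h | h | h
    · exact absurd hwt2 (ne_of_lt (pow_lt_one₀ zero_le h two_ne_zero))
    · exact h
    · exact absurd hwt2 (ne_of_gt (one_lt_pow₀ h two_ne_zero))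
  have hwt' : w t' = 1 := by rw [ht'def, map_mul, hw6, hwt, one_mul]
  -- `u = (1 + t')/2` is a root of `X² - X - m`
  set u : AlgebraicClosure (v.adicCompletion ℚ) := (1 + t') / 2 with hudef
  have h2u : 2 * u = 1 + t' := by rw [hudef]; field_simp
  have hu_eq : u ^ 2 = u + (m : AlgebraicClosure (v.adicCompletion ℚ)) := by
    have hm' : (g : AlgebraicClosure (v.adicCompletion ℚ)) = 4 * (m : AlgebraicClosure (v.adicCompletion ℚ)) + 1 := by
      have := congrArg (fun z : ℤ ↦ (z : AlgebraicClosure (v.adicCompletion ℚ))) hm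
      push_cast at this
      linear_combination this
    have h4u : (2 * u) ^ 2 = 4 * (u + (m : AlgebraicClosure (v.adicCompletion ℚ))) := by
      rw [h2u, add_sq, one_pow, mul_one, ht'2, hm']
      linear_combination (2 : AlgebraicClosure (v.adicCompletion ℚ)) * h2u
    have h4ne : (4 : AlgebraicClosure (v.adicCompletion ℚ)) ≠ 0 := by norm_num
    apply mul_left_cancel₀ h4ne
    linear_combination h4u
  -- `|u|_v ≤ 1`
  have hwm : w (m : AlgebraicClosure (v.adicCompletion ℚ)) ≤ 1 :=
    (mem_localAbsIntegers_iff_spectralValuation hw).1 (intCast_mem v.localAbsIntegers m)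
  have hwu : w u ≤ 1 := by
    by_contra hgt
    push Not at hgt
    have h1 : w (u ^ 2) ≤ max (w u) (w (m : AlgebraicClosure (v.adicCompletion ℚ))) := by
      rw [hu_eq]; exact Valuation.map_add w _ _
    rw [map_pow, max_eq_left (hwm.trans hgt.le)] at h1
    have h2 : w u < w u ^ 2 := by
      calc w u = w u * 1 := (mul_one _).symm
        _ < w u * w u := by gcongr
        _ = w u ^ 2 := (sq _).symm
    exact absurd h1 (not_le.mpr h2)
  -- inertia moves `u` by less than `1`
  obtain ⟨𝔐, h𝔐⟩ := v.localPrimesAbove_nonempty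
  have hσ' : σ ∈ 𝔐.inertia (absoluteGaloisGroup (v.adicCompletion ℚ)) := by
    rw [inertia_eq_absInertia hw h𝔐]; exact hσ
  have hlt : w (σ • u - u) < 1 := (mem_inertia_iff_spectralValuation hw h𝔐).1 hσ' u hwu
  -- `σ u` is a root of the same quadratic: `σ u = u` or `σ u = 1 - u`
  have hσm : σ • (m : AlgebraicClosure (v.adicCompletion ℚ)) = m := by
    rw [Field.absoluteGaloisGroup.smul_def, map_intCast]
  have hσu_eq : (σ • u) ^ 2 = σ • u + (m : AlgebraicClosure (v.adicCompletion ℚ)) := by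
    have h := congrArg (fun z ↦ σ • z) hu_eq
    simp only [smul_pow', smul_add, hσm] at h
    exact h
  have hcases : σ • u = u ∨ σ • u = 1 - u := by
    have h0 : (σ • u - u) * (σ • u - (1 - u)) = 0 := by
      have e : (σ • u - u) * (σ • u - (1 - u)) =
          ((σ • u) ^ 2 - σ • u - (m : AlgebraicClosure (v.adicCompletion ℚ))) -
            (u ^ 2 - u - (m : AlgebraicClosure (v.adicCompletion ℚ))) := by ring
      rw [e, hσu_eq, hu_eq]; ring
    rcases mul_eq_zero.mp h0 with h | h
    · exact Or.inl (sub_eq_zero.mp h)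
    · exact Or.inr (sub_eq_zero.mp h)
  have hσu : σ • u = u := by
    rcases hcases with h | h
    · exact h
    · exfalso
      have e : σ • u - u = -t' := by rw [h]; linear_combination (-1 : AlgebraicClosure (v.adicCompletion ℚ)) * h2u
      rw [e, Valuation.map_neg, hwt'] at hlt
      exact lt_irrefl _ hlt
  -- hence `σ t' = t'` and `σ t = t`
  have hσt' : σ • t' = t' := by
    have e : t' = 2 * u - 1 := by linear_combination (-1 : AlgebraicClosure (v.adicCompletion ℚ)) * h2u
    have hσ2 : σ • (2 : AlgebraicClosure (v.adicCompletion ℚ)) = 2 := by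
      rw [Field.absoluteGaloisGroup.smul_def, map_ofNat]
    have hσ1 : σ • (1 : AlgebraicClosure (v.adicCompletion ℚ)) = 1 := smul_one σ
    rw [e, smul_sub, smul_mul', hσ2, hσu, hσ1]
  have hσc6 : σ • (((integralModelInt W).c₆ : ℤ) : AlgebraicClosure (v.adicCompletion ℚ)) =
      (((integralModelInt W).c₆ : ℤ) : AlgebraicClosure (v.adicCompletion ℚ)) := by
    rw [Field.absoluteGaloisGroup.smul_def, map_intCast]
  have hσt : σ • t = t := by
    have h := hσt'
    rw [ht'def, smul_mul', hσc6] at h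
    exact mul_left_cancel₀ hc60 h
  rw [← Field.absoluteGaloisGroup.smul_def]
  exact hσt

end Summit.BirchSwinnertonDyer.Rank1Residual.X2.TateTwistUnramifiedAtTwo

end
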